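import Summits.Parity.GeneralizedHardyLittlewood.Theses.ChenParityOracleBLAP
import Summits.Parity.GeneralizedHardyLittlewood.Theorems.ChenParityOracleBLAPParityOracleChenLower
import Summits.Parity.GeneralizedHardyLittlewood.Theorems.ChenParityOracleBLAPParityOracleChenUpperSum
import Summits.Parity.GeneralizedHardyLittlewood.Theorems.ChenParityOracleBLAPParityOracleChenUpperB
import HarnessLib

/-!
# Route `ChenParityOracleBLAP` — crux S2 = `ParityOracleChen` (stmt-Parity-20046), PROVED

File 5/5, the closing file: `parityOracleChen_proof : ParityOracleChen`, i.e.
`HP1 → HP2 → TwinLowerDensity` — Chen's 1973 switching chain with the tree's PROVED linear-sieve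
constants run on the `λ = −1` subsequences of BOTH hosts. With `𝒜′(x) = {p + 2 ≤ x + 2 : λ = −1}`,
`B′(x) = {b ∈ B(x) : λ(b) = −1}`: the weighted-sieve inequality `ChenSieve.weightedSieve'`
(Nathanson Thm 10.2) for `𝒜′`, the comparison `T(𝒜′; z, y) ≤ y + S(B′, y)` (a prime `b` has
`λ(b) = −1`), the halved estimates (A′) `parity_twin_sieveLower`, (B′) `parity_twin_sieveUpperSum`,
(C′) `parity_twin_sieveUpperB`, and the observation that a survivor `n ∈ 𝒜′` with `Ω(n) ≤ 2` is a
PRIME `p + 2` (`Ω` odd and `≤ 2`), give `π₂(x) ≥ (κ/4) X V − O(x^{7/8}) ≥ 2κe^{−7} x/(log x)²`,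
`κ = (e^γ/4)(2 log 3 − log 6 − c) > 0` the tree's Chen constant (`chen_mainTermConstant_pos_holds`).
No Elliott–Halberstam input: every sieve level is `x^{1/2−ε}`; the parity information is exactly
HP1/HP2.

References: Chen Jing-run, Sci. Sinica 16 (1973) 157–176 [ChenSciSinica1973]; M. B. Nathanson,
*Additive Number Theory: The Classical Bases* (1996), Ch. 10 [Nathanson1996].
-/

namespace Summit.Parity.GeneralizedHardyLittlewood.Theorems

open Finset Filter Topology
open scoped ArithmeticFunction.Moebius ArithmeticFunction.Omega
open Literature.NumberTheory.Sieve Literature.NumberTheory.Sieve.Chen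
  Literature.NumberTheory.Sieve.ChenSieve Literature.NumberTheory.Sieve.SieveSequence

/-- **The third weight and the parity subset of `B`**: the elements `p + 2 = p₁p₂p₃` of the parity
subset `𝒜′(x)` counted by `T(𝒜′(x); z, y)` correspond to primes `p` of `B(x)`; those `≥ y` are
`y`-rough AND have `λ(p) = −1`, the others are fewer than `y`. Hence `T(𝒜′) ≤ y + S(B′(x), y)`,
`B′(x) = {b ∈ B(x) : λ(b) = −1}` (the tree's `Chen.tripleCount_twin_le` with the oracle on the
switched side, where it costs nothing: a prime has `λ = −1`). -/
theorem tripleCount_parity_le (x : ℕ) :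
    tripleCount ((twinSieveSet x).filter fun n => ArithmeticFunction.liouville n = -1) (twinZ x) (twinY x) ≤
      twinY x + roughCount ((chenSetB x).filter fun n => ArithmeticFunction.liouville n = -1) (twinY x) := by
  classical
  set z := twinZ x
  set y := twinY x
  set A' := (twinSieveSet x).filter fun n => ArithmeticFunction.liouville n = -1 with hA'
  have hA'sub : A' ⊆ twinSieveSet x := Finset.filter_subset _ _
  have hinj : Set.InjOn (fun n : ℕ => n - 2) (A'.filter fun n => IsChenTriple z y n) := by
    intro a ha b hb hab
    have ha2 : 2 ≤ a := by
      obtain ⟨p, -, -, -, rfl⟩ := mem_twinSieveSet.mp (hA'sub (Finset.mem_filter.mp ha).1); omega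
    have hb2 : 2 ≤ b := by
      obtain ⟨p, -, -, -, rfl⟩ := mem_twinSieveSet.mp (hA'sub (Finset.mem_filter.mp hb).1); omega
    simp only at hab
    omega
  have himage : (A'.filter fun n => IsChenTriple z y n).image (fun n : ℕ => n - 2) ⊆
      (chenSetB x).filter Nat.Prime := by
    intro m hm
    rw [Finset.mem_image] at hm
    obtain ⟨n, hn, rfl⟩ := hm
    rw [Finset.mem_filter] at hn ⊢
    obtain ⟨p, hp, -, hpx, rfl⟩ := mem_twinSieveSet.mp (hA'sub hn.1)
    obtain ⟨p₁, p₂, p₃, h₁, h₂, h₃, hz, hy, hy', h23, heq⟩ := hn.2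
    refine ⟨mem_chenSetB.mpr ⟨p₁, p₂, p₃, h₁, h₂, h₃, hz, hy, hy', h23, by omega, by omega⟩, ?_⟩
    simpa using hp
  calc tripleCount A' z y
      = #((A'.filter fun n => IsChenTriple z y n).image fun n : ℕ => n - 2) := by
        rw [tripleCount, Finset.card_image_of_injOn hinj]
    _ ≤ #((chenSetB x).filter Nat.Prime) := Finset.card_le_card himage
    _ ≤ #((chenSetB x).filter fun m => m.Prime ∧ m < y) +
          #((chenSetB x).filter fun m => m.Prime ∧ y ≤ m) := by
        rw [← Finset.card_union_of_disjoint]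
        · refine Finset.card_le_card fun m hm => ?_
          rw [Finset.mem_filter] at hm
          rw [Finset.mem_union, Finset.mem_filter, Finset.mem_filter]
          by_cases h : m < y
          · exact Or.inl ⟨hm.1, hm.2, h⟩
          · exact Or.inr ⟨hm.1, hm.2, not_lt.mp h⟩
        · rw [Finset.disjoint_filter]
          intro m _ h1 h2
          omega
    _ ≤ y + roughCount ((chenSetB x).filter fun n => ArithmeticFunction.liouville n = -1) y := by
        gcongr
        · calc #((chenSetB x).filter fun m => m.Prime ∧ m < y)
              ≤ #(Finset.range y) := by
                refine Finset.card_le_card fun m hm => ?_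
                rw [Finset.mem_filter] at hm
                exact Finset.mem_range.mpr hm.2.2
            _ = y := Finset.card_range y
        · rw [roughCount, Finset.filter_filter]
          refine Finset.card_le_card fun m hm => ?_
          rw [Finset.mem_filter] at hm ⊢
          refine ⟨hm.1, ?_, fun p hp => ?_⟩
          · rw [ArithmeticFunction.liouville_apply hm.2.1.ne_zero,
              ArithmeticFunction.cardFactors_apply_prime hm.2.1, pow_one]
          rw [Nat.mem_primeFactors] at hp
          have : p = m := (Nat.prime_dvd_prime_iff_eq hp.1 hm.2.1).mp hp.2.1
          omega

/-- **A survivor of the weighted sieve in the parity subset is a twin prime**: an element `n = p + 2`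
of `𝒜′(x)` with `Ω(n) ≤ 2` has `Ω(n)` odd, hence `n` is prime; so
`#{n ∈ 𝒜′(x) : Ω(n) ≤ 2} ≤ π₂(x)` (`Literature.NumberTheory.Sieve.twinPrimeCount`). -/
theorem almostPrimeTwoCount_parity_le (x : ℕ) :
    almostPrimeTwoCount ((twinSieveSet x).filter fun n => ArithmeticFunction.liouville n = -1) ≤
      twinPrimeCount x := by
  classical
  set A' := (twinSieveSet x).filter fun n => ArithmeticFunction.liouville n = -1 with hA'
  rw [almostPrimeTwoCount, twinPrimeCount]
  have hinj : Set.InjOn (fun n : ℕ => n - 2) (A'.filter fun n => Nat.IsAtMostAlmostPrime 2 n) := by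
    intro a ha b hb hab
    have ha2 : 2 ≤ a := by
      obtain ⟨p, -, -, -, rfl⟩ := mem_twinSieveSet.mp
        (Finset.mem_filter.mp (Finset.mem_filter.mp ha).1).1; omega
    have hb2 : 2 ≤ b := by
      obtain ⟨p, -, -, -, rfl⟩ := mem_twinSieveSet.mp
        (Finset.mem_filter.mp (Finset.mem_filter.mp hb).1).1; omega
    simp only at hab
    omega
  rw [← Finset.card_image_of_injOn hinj]
  refine Finset.card_le_card fun m hm => ?_
  rw [Finset.mem_image] at hm
  obtain ⟨n, hn, rfl⟩ := hm
  rw [Finset.mem_filter] at hn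
  obtain ⟨hnA', h2⟩ := hn
  rw [hA', Finset.mem_filter] at hnA'
  obtain ⟨hnA, hl⟩ := hnA'
  obtain ⟨p, hp, -, hpx, rfl⟩ := mem_twinSieveSet.mp hnA
  have hprime : (p + 2).Prime := prime_of_liouville_eq_neg_one_of_isAtMostAlmostPrime_two hl h2
  rw [Finset.mem_filter, Finset.mem_range]
  simp only [Nat.add_sub_cancel]
  exact ⟨by omega, hp, hprime⟩

/-- **HP1 ⇒ the oracle hypothesis for `𝒜(x)`**: the sum `∑_{p ≤ x, d ∣ p+2} λ(p+2)` of the route's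
hypothesis HP1 and `Λ_d(x) = ∑_{n ∈ 𝒜(x), d ∣ n} λ(n)` (`𝒜(x) = {p + 2 : 2 < p ≤ x}`) differ only by the
term `p = 2` (`λ(4) = 1`, present iff `d ∣ 4`), so `|Λ_d(x)| ≤ |HP1_d(x)| + 1`. -/
theorem abs_twinParitySum_le (x d : ℕ) :
    |∑ n ∈ (twinSieveSet x).filter (fun n => d ∣ n), (ArithmeticFunction.liouville n : ℝ)| ≤
      |∑ p ∈ (Nat.primesLE x).filter (fun p => d ∣ p + 2), (ArithmeticFunction.liouville (p + 2) : ℝ)| + 1 := by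
  classical
  -- `Λ_d` as a sum over primes `2 < p ≤ x`
  have h1 : ∑ n ∈ (twinSieveSet x).filter (fun n => d ∣ n), (ArithmeticFunction.liouville n : ℝ) =
      ∑ p ∈ ((Nat.primesLE x).filter (fun p => d ∣ p + 2)).filter (fun p => 2 < p),
        (ArithmeticFunction.liouville (p + 2) : ℝ) := by
    have hset : (twinSieveSet x).filter (fun n => d ∣ n) =
        (((Nat.primesLE x).filter (fun p => d ∣ p + 2)).filter (fun p => 2 < p)).map
          (addRightEmbedding 2) := by
      ext n
      rw [Finset.mem_filter, Finset.mem_map]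
      constructor
      · rintro ⟨hn, hdn⟩
        obtain ⟨p, hp, h2, hpx, rfl⟩ := mem_twinSieveSet.mp hn
        refine ⟨p, ?_, rfl⟩
        simp only [Finset.mem_filter, Nat.mem_primesLE]
        exact ⟨⟨⟨hpx, hp⟩, hdn⟩, h2⟩
      · rintro ⟨p, hp, rfl⟩
        simp only [Finset.mem_filter, Nat.mem_primesLE] at hp
        simp only [addRightEmbedding_apply]
        exact ⟨mem_twinSieveSet.mpr ⟨p, hp.1.1.2, hp.2, hp.1.1.1, rfl⟩, hp.1.2⟩
    rw [hset, Finset.sum_map]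
    rfl
  rw [h1]
  set S := (Nat.primesLE x).filter (fun p => d ∣ p + 2) with hS
  have hsplit := Finset.sum_filter_add_sum_filter_not S (fun p => 2 < p)
    (fun p => (ArithmeticFunction.liouville (p + 2) : ℝ))
  -- the complementary part has at most the single term `p = 2`
  have hrest : |∑ p ∈ S.filter (fun p => ¬ 2 < p), (ArithmeticFunction.liouville (p + 2) : ℝ)| ≤ 1 := by
    have hsub : S.filter (fun p => ¬ 2 < p) ⊆ {2} := by
      intro p hp
      rw [hS, Finset.mem_filter, Finset.mem_filter, Nat.mem_primesLE] at hp
      rw [Finset.mem_singleton]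
      have := hp.1.1.2.two_le
      omega
    calc |∑ p ∈ S.filter (fun p => ¬ 2 < p), (ArithmeticFunction.liouville (p + 2) : ℝ)|
        ≤ ∑ p ∈ S.filter (fun p => ¬ 2 < p), |(ArithmeticFunction.liouville (p + 2) : ℝ)| :=
          Finset.abs_sum_le_sum_abs _ _
      _ ≤ ∑ p ∈ ({2} : Finset ℕ), |(ArithmeticFunction.liouville (p + 2) : ℝ)| :=
          Finset.sum_le_sum_of_subset_of_nonneg hsub fun _ _ _ => abs_nonneg _
      _ ≤ 1 := by rw [Finset.sum_singleton]; exact abs_liouville_le_one _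
  have htri := abs_add_le (∑ p ∈ S, (ArithmeticFunction.liouville (p + 2) : ℝ))
    (-(∑ p ∈ S.filter (fun p => ¬ 2 < p), (ArithmeticFunction.liouville (p + 2) : ℝ)))
  rw [abs_neg] at htri
  have heq : ∑ p ∈ S.filter (fun p => 2 < p), (ArithmeticFunction.liouville (p + 2) : ℝ) =
      ∑ p ∈ S, (ArithmeticFunction.liouville (p + 2) : ℝ) +
        -(∑ p ∈ S.filter (fun p => ¬ 2 < p), (ArithmeticFunction.liouville (p + 2) : ℝ)) := by
    linarith
  rw [heq]
  linarith

/-- **HP1 in the route's form implies the oracle hypothesis for `𝒜(x)`** used by (A′) and (B′):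
`∑_{d ≤ x^{1/2−ε}} |Λ_d(x)| ≤ ∑_{d ≤ x^{1/2−ε}} |HP1_d(x)| + x^{1/2} ≤ η x/(log x)²` for large `x`. -/
theorem twinParity_oracle_of_HP1
    (hHP1 : ∀ ε : ℝ, 0 < ε → ∀ η : ℝ, 0 < η → ∃ x₀ : ℕ, ∀ x : ℕ, x₀ ≤ x →
      (∑ d ∈ Finset.Icc 1 ⌊(x : ℝ) ^ (1 / 2 - ε)⌋₊,
        |∑ p ∈ (Nat.primesLE x).filter (fun p => d ∣ p + 2), (ArithmeticFunction.liouville (p + 2) : ℝ)|) ≤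
          η * (x : ℝ) / Real.log x ^ 2) :
    ∀ ε : ℝ, 0 < ε → ∀ η : ℝ, 0 < η → ∀ᶠ x : ℕ in atTop,
      (∑ d ∈ Finset.Icc 1 ⌊(x : ℝ) ^ (1 / 2 - ε)⌋₊,
        |∑ n ∈ (twinSieveSet x).filter (fun n => d ∣ n), (ArithmeticFunction.liouville n : ℝ)|) ≤
          η * (x : ℝ) / Real.log x ^ 2 := by
  intro ε hε η hη
  obtain ⟨x₀, hx₀⟩ := hHP1 ε hε (η / 2) (by positivity)
  filter_upwards [eventually_ge_atTop x₀, eventually_ge_atTop 256,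
    eventually_twin_errorTerms_le (show 0 < η / 2 by positivity)] with x hx hx256 hjunk
  have hx1 : (1 : ℝ) ≤ x := by exact_mod_cast (show 1 ≤ x by omega)
  have hx0 : (0 : ℝ) < x := by linarith
  have h1 := hx₀ x hx
  -- the number of terms is `≤ x^{1/2-ε} ≤ x^{7/8} ≤ 6 x^{7/8} ≤ (η/2) x/(log x)²`
  have hcard : (#(Finset.Icc 1 ⌊(x : ℝ) ^ (1 / 2 - ε)⌋₊) : ℝ) ≤ η / 2 * x / Real.log x ^ 2 := by
    rw [Nat.card_Icc, Nat.add_sub_cancel]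
    calc (⌊(x : ℝ) ^ (1 / 2 - ε)⌋₊ : ℝ) ≤ (x : ℝ) ^ (1 / 2 - ε) := Nat.floor_le (Real.rpow_nonneg hx0.le _)
      _ ≤ (x : ℝ) ^ (7 / 8 : ℝ) := Real.rpow_le_rpow_of_exponent_le hx1 (by linarith)
      _ ≤ 6 * (x : ℝ) ^ (7 / 8 : ℝ) := by
          have := Real.rpow_nonneg hx0.le (7 / 8 : ℝ); linarith
      _ ≤ η / 2 * x / Real.log x ^ 2 := hjunk
  calc (∑ d ∈ Finset.Icc 1 ⌊(x : ℝ) ^ (1 / 2 - ε)⌋₊,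
        |∑ n ∈ (twinSieveSet x).filter (fun n => d ∣ n), (ArithmeticFunction.liouville n : ℝ)|)
      ≤ ∑ d ∈ Finset.Icc 1 ⌊(x : ℝ) ^ (1 / 2 - ε)⌋₊,
          (|∑ p ∈ (Nat.primesLE x).filter (fun p => d ∣ p + 2),
            (ArithmeticFunction.liouville (p + 2) : ℝ)| + 1) :=
        Finset.sum_le_sum fun d _ => abs_twinParitySum_le x d
    _ = (∑ d ∈ Finset.Icc 1 ⌊(x : ℝ) ^ (1 / 2 - ε)⌋₊,
          |∑ p ∈ (Nat.primesLE x).filter (fun p => d ∣ p + 2),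
            (ArithmeticFunction.liouville (p + 2) : ℝ)|) + #(Finset.Icc 1 ⌊(x : ℝ) ^ (1 / 2 - ε)⌋₊) := by
        rw [Finset.sum_add_distrib, Finset.sum_const, nsmul_eq_mul, mul_one]
    _ ≤ η / 2 * x / Real.log x ^ 2 + η / 2 * x / Real.log x ^ 2 := add_le_add h1 hcard
    _ = η * x / Real.log x ^ 2 := by ring

/-- **S2 = `ParityOracleChen` (route `ChenParityOracleBLAP`, crux stmt-Parity-20046), PROVED:**
`HP1 → HP2 → TwinLowerDensity`. Chen's switching chain of the tree run on the parity subsequences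
`λ = −1` of BOTH hosts: the weighted-sieve inequality `ChenSieve.weightedSieve'` (Nathanson Thm 10.2)
for `𝒜′(x) = {p + 2 ≤ x + 2 : λ(p + 2) = −1}`, the three sieve estimates with HALVED main terms —
(A′) `parity_twin_sieveLower`, (B′) `parity_twin_sieveUpperSum` (oracle remainders = HP1) and
(C′) `parity_twin_sieveUpperB` (oracle remainder = HP2 on the sharp switched set `B(x)`), all from
the tree's PROVED Jurkat–Richert/Iwaniec linear sieve and Bombieri–Vinogradov through the twisted
Rosser sieve `Iwaniec1980_twisted_{lower,upper}_of_half_lt` — and `T(𝒜′) ≤ y + S(B′, y)`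
(`tripleCount_parity_le`). Every survivor `n ∈ 𝒜′(x)` with `Ω(n) ≤ 2` is a prime `p + 2`
(`almostPrimeTwoCount_parity_le`), so with `κ = (e^γ/4)(2 log 3 − log 6 − c) > 0`
(`chen_mainTermConstant_pos_holds`) and `ε = κ/8`:
`π₂(x) ≥ (κ/4) X V − y/2 − (x+2)/(z−1) ≥ 2κe^{−7} x/(log x)²` for all large `x`. -/
theorem parityOracleChen_proof :
    Summit.Parity.GeneralizedHardyLittlewood.Theses.ChenParityOracleBLAP.ParityOracleChen := by
  unfold Summit.Parity.GeneralizedHardyLittlewood.Theses.ChenParityOracleBLAP.ParityOracleChen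
    Summit.Parity.GeneralizedHardyLittlewood.Theses.ChenParityOracleBLAP.TwinLowerDensity
  intro hHP1 hHP2
  -- the oracle hypotheses in the forms consumed by (A′), (B′), (C′)
  have hΛA := twinParity_oracle_of_HP1 hHP1
  have hΛB : ∀ ε : ℝ, 0 < ε → ∀ η : ℝ, 0 < η → ∀ᶠ x : ℕ in atTop,
      (∑ d ∈ Finset.Icc 1 ⌊(x : ℝ) ^ (1 / 2 - ε)⌋₊,
        |∑ b ∈ (chenSetB x).filter (fun b => d ∣ b), (ArithmeticFunction.liouville b : ℝ)|) ≤
          η * (x : ℝ) / Real.log x ^ 2 := by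
    intro ε hε η hη
    obtain ⟨x₀, hx₀⟩ := hHP2 ε hε η hη
    exact Filter.eventually_atTop.mpr ⟨x₀, hx₀⟩
  have hA := parity_twin_sieveLower hΛA
  have hB := parity_twin_sieveUpperSum hΛA
  have hC := parity_twin_sieveUpperB hΛB
  -- Chen's constant
  set κ := Real.exp Real.eulerMascheroniConstant / 4 * (2 * Real.log 3 - Real.log 6 - switchingConstant)
    with hκ
  have hκpos : 0 < κ := by
    have : 0 < 2 * Real.log 3 - Real.log 6 - switchingConstant := chen_mainTermConstant_pos_holds
    positivity
  refine ⟨2 * κ * Real.exp (-7), by positivity, ?_⟩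
  have hε : 0 < κ / 8 := by positivity
  have hev : ∀ᶠ x : ℕ in atTop, 2 * κ * Real.exp (-7) * (x : ℝ) / Real.log (x : ℝ) ^ 2 ≤
      (twinPrimeCount x : ℝ) := by
    filter_upwards [hA _ hε, hB _ hε, hC _ hε, eventually_ge_atTop 6561,
      eventually_twin_errorTerms_le (show 0 < 2 * κ * Real.exp (-7) by positivity)]
      with x hAx hBx hCx hx hjunk
    set A' := (twinSieveSet x).filter fun n => ArithmeticFunction.liouville n = -1 with hA'
    have hA'sub : A' ⊆ Finset.Ioc 0 (x + 2) := (Finset.filter_subset _ _).trans (twinSieveSet_subset_Ioc x)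
    have hW := weightedSieve' (A := A') (z := twinZ x) (y := twinY x) hA'sub (lt_twinY_pow x)
      (two_le_twinZ (by omega))
    have hT : (tripleCount A' (twinZ x) (twinY x) : ℝ) ≤
        twinY x + roughCount ((chenSetB x).filter fun n => ArithmeticFunction.liouville n = -1) (twinY x) := by
      exact_mod_cast tripleCount_parity_le x
    have hP : (almostPrimeTwoCount A' : ℝ) ≤ twinPrimeCount x := by
      exact_mod_cast almostPrimeTwoCount_parity_le x
    have hM := twinMainTerm_ge hx
    have hM0 := twinMainTerm_nonneg x
    have hJ := twin_errorTerms_le (show 256 ≤ x by omega)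
    have hkey : (Real.exp Real.eulerMascheroniConstant * Real.log 3 / 4 - κ / 8) * twinMainTerm x -
        (Real.exp Real.eulerMascheroniConstant * Real.log 6 / 4 + κ / 8) * twinMainTerm x / 2 -
        (switchingConstant * Real.exp Real.eulerMascheroniConstant / 4 + κ / 8) * twinMainTerm x / 2 =
          κ / 4 * twinMainTerm x := by
      rw [hκ]; ring
    have hcast : ((x + 2 : ℕ) : ℝ) = (x : ℝ) + 2 := by push_cast; ring
    rw [hcast] at hW
    set L := (x : ℝ) / Real.log x ^ 2 with hL
    have hM' : 16 * Real.exp (-7) * L ≤ twinMainTerm x := by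
      rw [hL, show 16 * Real.exp (-7) * ((x : ℝ) / Real.log x ^ 2) =
        16 * Real.exp (-7) * x / Real.log x ^ 2 by ring]
      exact hM
    have hjunk' : 6 * (x : ℝ) ^ (7 / 8 : ℝ) ≤ 2 * κ * Real.exp (-7) * L := by
      rw [hL, show 2 * κ * Real.exp (-7) * ((x : ℝ) / Real.log x ^ 2) =
        2 * κ * Real.exp (-7) * x / Real.log x ^ 2 by ring]
      exact hjunk
    rw [show 2 * κ * Real.exp (-7) * (x : ℝ) / Real.log x ^ 2 = 2 * κ * Real.exp (-7) * L by
      rw [hL]; ring]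
    have h1 : 4 * κ * Real.exp (-7) * L ≤ κ / 4 * twinMainTerm x :=
      calc 4 * κ * Real.exp (-7) * L = κ / 4 * (16 * Real.exp (-7) * L) := by ring
        _ ≤ κ / 4 * twinMainTerm x := mul_le_mul_of_nonneg_left hM' (by positivity)
    linarith
  obtain ⟨x₀, hx₀⟩ := Filter.eventually_atTop.mp hev
  exact ⟨x₀, fun x hx => hx₀ x hx⟩

end Summit.Parity.GeneralizedHardyLittlewood.Theorems
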